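import Mathlib
import Literature.LinearAlgebra.Matrix.BipartiteForestFormula
import Literature.NumberTheory.EllipticCurves.HeathBrown1994.CongruentTwoSelmerMonskyMatrix

/-!
# Smith's matrix `M₁ = [[A + Aᵀ, Aᵀ], [A, D_z]]` as a forest sum, for every number of prime factors

A. Smith, *The congruent numbers have positive natural density*, arXiv:1603.08479, Theorem 2.2 row 1 /
Proposition 2.4 [Smith2016CongruentDensity]: for `A` an `r × r` matrix over `𝔽₂` with zero row sums and
`z ∈ 𝔽₂^r`, Smith proves the recursion (his (eq:main_rec))
`det M₁(A, z) = Σ_{1 ∈ S} (1 + Σ_S yᵢ)(1 + Σ_S zᵢ) det Q(A, z)[S] · det M₁(A, z)[S′]`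
by a four-page count of pairs of involutions.  Here we obtain the closed form behind it for EVERY `r`
and WITHOUT the reciprocity hypothesis `A_ij + A_ji = yᵢ yⱼ`:

* `det_fromBlocks_add_transpose_eq_det_bigN` — the congruence
  `[[I, I],[0, I]] · M₁ · [[I, 0],[I, I]] = [[D_z, (A + D_z)ᵀ], [A + D_z, D_z]]` (over `𝔽₂`), i.e. `M₁` is
  congruent to the doubled matrix of the arc weights `A` with marks `z`, root weights `z` and extra
  root weights `z` (`bigN a univ z z z` of `BipartiteForestMatrix`);
* `det_fromBlocks_add_transpose_eq_setExp` — hence, by the bipartite all-minors forest formula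
  (`det_bigN_eq_setExp`, [Chaiken1982] over `𝔽₂`),
  `det M₁(A, z) = Σ_{π ∈ Partitions} ∏_{B ∈ π} (1 + Σ_{i∈B} zᵢ) · q_z(A^B)`,
  `q_z(B) = Σ_{t ∈ B} z_t κ_t(B)` (`κ_t` = principal minor of the re-normalised block `A_Rows[B,B]`
  deleting `t` = `det Q(A, z)[B]` expanded along the `z`-column);
* `det_smithMatrixOne_eq_setExp` — the instance `A = ` Monsky's `legendreMatrix p`, `zᵢ = (2/pᵢ)₊`.
Under reciprocity `(1 + Σ_B zᵢ) q_z(B) = (1 + Σ_B yᵢ)(1 + Σ_B zᵢ) q_z(B)` (the column sums of `A^B`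
are `(1 + Σ_B y) y`, so `q_z(B) = 0` when `Σ_B y = 1`, `Σ_B z = 0`), and by Rédei–Reichardt
(`CongruentNumberRedeiDeterminant`) the block weight is `[d_B ≡ 1 (8)] · g(d_B)`: this is the route to
`smith_thm22_rowOne` for all `k` (the dictionary with `genusSum₁` is the remaining bookkeeping, see the
cell note `PROOF-B-FOREST-note.md`).
-/

namespace Literature.NumberTheory.EllipticCurves.Smith2016

open _root_.Matrix Finset Literature.LinearAlgebra.Matrix Literature.Combinatorics.Enumerative
open Literature.NumberTheory.EllipticCurves.HeathBrown1994

variable {V : Type*} [Fintype V]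

section Congruence

variable [DecidableEq V]

omit [Fintype V] [DecidableEq V] in
/-- Over `𝔽₂` a matrix plus itself vanishes. [cite: Smith2016CongruentDensity, §2 (chunk p0005 L11: matrices over 𝔽₂)] -/
theorem matrix_add_self (X : Matrix V V (ZMod 2)) : X + X = 0 := by
  ext i j
  exact CharTwo.add_self_eq_zero (X i j)

/-- **The congruence.** `[[I, I],[0, I]] · [[A + Aᵀ, Aᵀ],[A, D]] · [[I, 0],[I, I]] =
[[D, Aᵀ + D],[A + D, D]]` over `𝔽₂` (for any `A` and any `D`).
[cite: Smith2016CongruentDensity, §2 Thm. 2.2 row 1 (the matrix `M₁`)] -/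
theorem conj_fromBlocks_add_transpose (A D : Matrix V V (ZMod 2)) :
    fromBlocks 1 1 0 1 * fromBlocks (A + Aᵀ) Aᵀ A D * fromBlocks 1 0 1 1 =
      fromBlocks D (Aᵀ + D) (A + D) D := by
  rw [fromBlocks_multiply, fromBlocks_multiply]
  simp only [Matrix.one_mul, Matrix.mul_one, Matrix.zero_mul, Matrix.mul_zero, zero_add]
  have h1 : A + Aᵀ + A = Aᵀ := by
    rw [add_comm (A + Aᵀ) A, ← add_assoc, matrix_add_self, zero_add]
  rw [h1, ← add_assoc, matrix_add_self, zero_add]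

/-- **`det M₁ = det [[D, (A + D)ᵀ], [A + D, D]]`** for a diagonal (indeed any symmetric) `D` over `𝔽₂`.
[cite: Smith2016CongruentDensity, §2 Thm. 2.2 row 1] -/
theorem det_fromBlocks_add_transpose (A D : Matrix V V (ZMod 2)) (hD : Dᵀ = D) :
    (fromBlocks (A + Aᵀ) Aᵀ A D).det = (fromBlocks D (A + D)ᵀ (A + D) D).det := by
  have h := congrArg Matrix.det (conj_fromBlocks_add_transpose A D)
  rw [det_mul, det_mul, det_fromBlocks_zero₂₁, det_fromBlocks_zero₁₂] at h
  simp only [det_one, one_mul, mul_one] at h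
  rw [h, transpose_add, hD]

/-- The doubled matrix of the arc weights read off a zero-row-sum matrix `A` (weights `a i j = A i j`),
on the whole vertex set, with marks, roots and extra roots all equal to `z`, IS
`[[D_z, (A + D_z)ᵀ], [A + D_z, D_z]]`. [cite: Smith2016CongruentDensity, §2 Prop. 2.4 (the matrix `A` with `A_ii = Σ_{j≠i} A_ij`)] -/
theorem bigN_univ_eq_fromBlocks (A : Matrix V V (ZMod 2)) (hA : ∀ i, A i i = ∑ j ∈ univ.erase i, A i j)
    (z : V → ZMod 2) :
    bigN (fun i j => A i j) univ z z z =
      fromBlocks (diagonal z) (A + diagonal z)ᵀ (A + diagonal z) (diagonal z) := by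
  have hP : lapIn (fun i j => A i j) univ z = A + diagonal z := by
    ext i j
    rw [lapIn_apply, Matrix.add_apply, diagonal_apply]
    simp only [mem_univ, and_self, if_true]
    by_cases hij : i = j
    · subst hij; rw [if_pos rfl, if_pos rfl, hA i, add_comm]
    · rw [if_neg hij, if_neg hij, add_zero]
  unfold bigN
  rw [hP]
  congr 1 <;> (ext i j; simp [diagonal_apply])

/-- **`det M₁(A, z) = det N(A; z, z, z)`**: Smith's matrix has the determinant of the doubled matrix of
the arc weights `A` (zero row sums) with `y = z = ℓ = z`. [cite: Smith2016CongruentDensity, §2 Thm. 2.2 row 1 / Prop. 2.4] -/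
theorem det_fromBlocks_add_transpose_eq_det_bigN (A : Matrix V V (ZMod 2))
    (hA : ∀ i, A i i = ∑ j ∈ univ.erase i, A i j) (z : V → ZMod 2) :
    (fromBlocks (A + Aᵀ) Aᵀ A (diagonal z)).det = (bigN (fun i j => A i j) univ z z z).det := by
  rw [det_fromBlocks_add_transpose A (diagonal z) (diagonal_transpose z), bigN_univ_eq_fromBlocks A hA z]

end Congruence

section Forest

variable [LinearOrder V]

/-- **Smith's `det M₁` as a forest sum, for every size and WITHOUT reciprocity**: for `A` over `𝔽₂`
with zero row sums (`A_ii = Σ_{j≠i} A_ij`) and any `z`,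
`det [[A + Aᵀ, Aᵀ], [A, D_z]] = Σ_{π ∈ Partitions} ∏_{B ∈ π} (1 + Σ_{i ∈ B} zᵢ) · q_z(A^B)` where
`q_z(B) = Σ_{t∈B} z_t κ_t(B)` and `κ_t(B)` is the principal minor of the row-re-normalised block
`A_Rows[B, B]` deleting `t`. [cite: Smith2016CongruentDensity, §2 Prop. 2.4 (closed form of the recursion (eq:main_rec))] [cite: Chaiken1982, §2 (all minors matrix tree theorem, over 𝔽₂)] -/
theorem det_fromBlocks_add_transpose_eq_setExp (A : Matrix V V (ZMod 2))
    (hA : ∀ i, A i i = ∑ j ∈ univ.erase i, A i j) (z : V → ZMod 2) :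
    (fromBlocks (A + Aᵀ) Aᵀ A (diagonal z)).det =
      setExp (fun B => (1 + ∑ i ∈ B, z i) * qwt (fun i j => A i j) z B) univ := by
  rw [det_fromBlocks_add_transpose_eq_det_bigN A hA z, det_bigN_eq_setExp]
  refine setExp_congr fun B _ _ => ?_
  rw [fwt]
  ring

/-- **Smith's Theorem 2.2 row 1 in forest form, every `k`**: for `p : Fin k → ℕ` and Monsky's matrix
`A = legendreMatrix p`, `zᵢ = (2/pᵢ)₊`:
`det M₁ = Σ_{π ∈ Partitions(Fin k)} ∏_{B ∈ π} (1 + Σ_{i∈B} (2/pᵢ)₊) · q_z(A^B)`.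
[cite: Smith2016CongruentDensity, §2 Thm. 2.2 row 1 / Prop. 2.4] -/
theorem det_smithMatrixOne_eq_setExp {k : ℕ} (p : Fin k → ℕ) :
    (fromBlocks (legendreMatrix p + (legendreMatrix p)ᵀ) (legendreMatrix p)ᵀ (legendreMatrix p)
      (legendreDiagonal p 2)).det =
      setExp (fun B => (1 + ∑ i ∈ B, addLegendreSym 2 (p i)) *
        qwt (fun i j => legendreMatrix p i j) (fun i => addLegendreSym 2 (p i)) B) univ := by
  have hA : ∀ i, legendreMatrix p i i = ∑ j ∈ univ.erase i, legendreMatrix p i j := by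
    intro i
    rw [legendreMatrix, Matrix.of_apply, if_pos rfl]
    exact sum_congr rfl fun j hj => by rw [Matrix.of_apply, if_neg (ne_of_mem_erase hj).symm]
  rw [legendreDiagonal]
  exact det_fromBlocks_add_transpose_eq_setExp (legendreMatrix p) hA _

/-- **The matrix-forest theorem over `𝔽₂`** (principal minors): `det (L_D + D_ℓ) =
Σ_{π} ∏_{B ∈ π} q_ℓ(B)` — the mod-2 count of spanning rooted forests with root weights `ℓ`
(the case `y = z = 0` of the bipartite formula). [cite: ChebotarevAgaev2002, §3 Thm. 2 and §4 Thm. 3 (matrix-forest theorems)] -/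
theorem det_lap_eq_setExp (a : V → V → ZMod 2) (D : Finset V) (ℓ : V → ZMod 2) :
    (lap a D ℓ).det = setExp (qwt a ℓ) D := by
  rw [← det_bigN_zero_zero, det_bigN_eq_setExp, fwt_zero_zero]

end Forest

end Literature.NumberTheory.EllipticCurves.Smith2016
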